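/-
Copyright (c) 2026 The decomp-a2c cell. All rights reserved.
Released under Apache 2.0 license as described in the file LICENSE.
-/
import Summits.AtomisticToContinuum.Crystallization.Theorems.ChartedZeroExcessLayeredLatticeLiouvilleWA

/-!
# ChartedZeroExcessLayeredLatticeLiouville — part WB «WindowStability»: the LOCAL STABILITY of the window inverse
  (decomp-a2c-lens-2, g58; helper of stmt-AtomisticToContinuum-26636, leaf (LD′) `ModalLipschitzZ`; brick (4a) `ModalLipschitzAt`, vertical half (4a⊥),
  step (E) of memo NODE-g58c)

VS `flux_window_solve` SOLVES the flux-block system on a window; the vertical half of the modal-Lipschitz estimate needs the converse direction for an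
ARBITRARY increment field `Δ : ℤ → E3` (the vertical increments of one column of a harmonic field, which are not supported in any window): the increment
at the centre `k₀` of a window `W = Icc (k₀ − R) (k₀ + R)` is controlled by the column's full chain fluxes `blockApply B T Δ` ON the window plus a DAMPED
contribution of the increments outside it,
★ `increment_le_local`: `‖Δ k₀‖ ≤ modeConst·(H + stabConst·(R+2)⁻²·D)` whenever `‖blockApply (fluxBlock …) T Δ n‖ ≤ H` on `W` and `‖Δ k‖ ≤ D` on `T ∖ W`
(`stabConst c δ = 2588·F·L²`, `L = decayScale c δ`; all constants `ϱ`-, window- and word-uniform).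
Proof: VN `window_inverse_bound` (polynomial profile at the decay scale, VQ `flux_coercive`, VS moments) applied to the truncation `truncW W Δ`, whose window
fluxes differ from the full ones by `Σ_{k ∈ T∖W} B n k (Δ k)`, of norm `≤ 588·F·(R+2−|n−k₀|)⁻²·D` by VR's block decay (VY `sum_bandWt_le_far`); the weighted
sum `Σ_n ω_L(k₀−n)⁻¹(R+2−|n−k₀|)⁻²` is `≤ 22·L³·(R+2)⁻²` by the elementary `inv_mul_weight_le` (`1/(xy) ≤ (L/M)(1/x+1/y)` when `M ≤ L(x+y)`).
-/

namespace Summit.AtomisticToContinuum.Crystallization.Theorems.ChartedZeroExcessLayeredLatticeLiouville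

open Summit.AtomisticToContinuum.Crystallization.Theorems.ChartedPlanarOrderRigidityDoor (E3)
open Finset
open scoped InnerProductSpace RealInnerProductSpace BigOperators

noncomputable section WindowStability

variable {c : ℝ} {a b : E3} {w : ℤ → E3}

/-! ### WB.1  Truncation to a window and splitting of the block operator -/

/-- the truncation of an increment field to a window. -/
def truncW (W : Finset ℤ) (Δ : ℤ → E3) : ℤ → E3 := fun k => if k ∈ W then Δ k else 0

/-- on the window the truncation is the field. [formal bookkeeping] -/
theorem truncW_of_mem {W : Finset ℤ} (Δ : ℤ → E3) {k : ℤ} (hk : k ∈ W) : truncW W Δ k = Δ k := if_pos hk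

/-- off the window the truncation vanishes. [formal bookkeeping] -/
theorem truncW_of_not_mem {W : Finset ℤ} (Δ : ℤ → E3) {k : ℤ} (hk : k ∉ W) : truncW W Δ k = 0 := if_neg hk

/-- the window operator only sees the field on the window. [formal bookkeeping] -/
theorem blockApply_truncW (B : ℤ → ℤ → (E3 →L[ℝ] E3)) (W : Finset ℤ) (Δ : ℤ → E3) (n : ℤ) :
    blockApply B W (truncW W Δ) n = blockApply B W Δ n := by
  unfold blockApply
  exact sum_congr rfl fun k hk => by rw [truncW_of_mem Δ hk]

/-- splitting the block operator of a big window `T` into the part on `W ⊆ T` and the part on `T ∖ W`. [formal bookkeeping] -/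
theorem blockApply_split (B : ℤ → ℤ → (E3 →L[ℝ] E3)) {W T : Finset ℤ} (hWT : W ⊆ T) (Δ : ℤ → E3) (n : ℤ) :
    blockApply B T Δ n = blockApply B W Δ n + ∑ k ∈ T \ W, B n k (Δ k) := by
  unfold blockApply
  rw [← sum_sdiff hWT, add_comm]

/-- the off-window part is controlled by the block decay: `‖Σ_{k ∈ P} B n k (Δ k)‖ ≤ 196·F·(Σ_{k∈P} bandWt n k)·D`. [formal bookkeeping] -/
theorem norm_sum_fluxBlock_apply_le (hc : 0 < c) (hL : IsLayeredCrystal c a b w) (ϱ : ℝ) (P : Finset ℤ) (Δ : ℤ → E3) (n : ℤ) {D : ℝ}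
    (hD : ∀ k ∈ P, ‖Δ k‖ ≤ D) :
    ‖∑ k ∈ P, fluxBlock hc hL ϱ n k (Δ k)‖ ≤ 196 * kernelConst c * (∑ k ∈ P, bandWt n k) * D := by
  have hF := kernelConst_nonneg hc
  calc ‖∑ k ∈ P, fluxBlock hc hL ϱ n k (Δ k)‖ ≤ ∑ k ∈ P, ‖fluxBlock hc hL ϱ n k (Δ k)‖ := norm_sum_le _ _
    _ ≤ ∑ k ∈ P, 196 * kernelConst c * bandWt n k * D := sum_le_sum fun k hk =>
        calc ‖fluxBlock hc hL ϱ n k (Δ k)‖ ≤ ‖fluxBlock hc hL ϱ n k‖ * ‖Δ k‖ := ContinuousLinearMap.le_opNorm _ _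
          _ ≤ 196 * kernelConst c * bandWt n k * D :=
              mul_le_mul (norm_fluxBlock_le_decay hc hL ϱ n k) (hD k hk) (norm_nonneg _) (by unfold bandWt; positivity)
    _ = 196 * kernelConst c * (∑ k ∈ P, bandWt n k) * D := by rw [mul_sum, sum_mul]

/-! ### WB.2  The weights -/

/-- `1/(x·y)² ≤ 2(L/M)²(1/x² + 1/y²)` whenever `M ≤ L(x + y)` (from `1/(xy) = (1/x + 1/y)/(x + y)`). [formal bookkeeping] -/
theorem inv_mul_weight_le {x y L M : ℝ} (hx : 0 < x) (hy : 0 < y) (hM : 0 < M) (hsum : M ≤ L * (x + y)) :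
    (x ^ 2)⁻¹ * (y⁻¹) ^ 2 ≤ 2 * L ^ 2 * (M⁻¹) ^ 2 * ((x ^ 2)⁻¹ + (y⁻¹) ^ 2) := by
  have hxy : 0 < x * y := mul_pos hx hy
  have hLM : 1 ≤ L * (x + y) / M := by rw [le_div_iff₀ hM, one_mul]; exact hsum
  have h1 : (x * y)⁻¹ ≤ L * M⁻¹ * (x⁻¹ + y⁻¹) := by
    have e : x⁻¹ + y⁻¹ = (x + y) * (x * y)⁻¹ := by field_simp; ring
    rw [e, show L * M⁻¹ * ((x + y) * (x * y)⁻¹) = (L * (x + y) / M) * (x * y)⁻¹ by rw [div_eq_mul_inv]; ring]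
    calc (x * y)⁻¹ = 1 * (x * y)⁻¹ := (one_mul _).symm
      _ ≤ (L * (x + y) / M) * (x * y)⁻¹ := mul_le_mul_of_nonneg_right hLM (inv_nonneg.mpr hxy.le)
  have h0 : 0 ≤ (x * y)⁻¹ := inv_nonneg.mpr hxy.le
  have h2 : ((x * y)⁻¹) ^ 2 ≤ (L * M⁻¹ * (x⁻¹ + y⁻¹)) ^ 2 := pow_le_pow_left₀ h0 h1 2
  have h3 : (x⁻¹ + y⁻¹) ^ 2 ≤ 2 * ((x ^ 2)⁻¹ + (y⁻¹) ^ 2) := by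
    rw [← inv_pow]; nlinarith [sq_nonneg (x⁻¹ - y⁻¹)]
  have h4 : 0 ≤ (L * M⁻¹) ^ 2 := sq_nonneg _
  calc (x ^ 2)⁻¹ * (y⁻¹) ^ 2 = ((x * y)⁻¹) ^ 2 := by rw [mul_inv, mul_pow, inv_pow]; ring
    _ ≤ (L * M⁻¹ * (x⁻¹ + y⁻¹)) ^ 2 := h2
    _ = (L * M⁻¹) ^ 2 * (x⁻¹ + y⁻¹) ^ 2 := by ring
    _ ≤ (L * M⁻¹) ^ 2 * (2 * ((x ^ 2)⁻¹ + (y⁻¹) ^ 2)) := mul_le_mul_of_nonneg_left h3 h4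
    _ = 2 * L ^ 2 * (M⁻¹) ^ 2 * ((x ^ 2)⁻¹ + (y⁻¹) ^ 2) := by ring

/-- the pointwise weight bound on the window `|k₀ − n| ≤ R`: with `j = |k₀ − n|`, `s = R + 1 − j`,
`ω_L(j)⁻¹·(s+1)⁻² ≤ 2L²(R+2)⁻²(ω_L(j)⁻¹ + (s+1)⁻²)` (`R + 2 ≤ L(1 + j/L + R + 2 − j)` for `L ≥ 1`). [formal bookkeeping] -/
theorem window_weight_le {L : ℝ} (hL1 : 1 ≤ L) {j R : ℕ} (hjR : j ≤ R) :
    ((1 + ((j : ℕ) : ℝ) / L) ^ 2)⁻¹ * (((((R + 1 - j : ℕ)) : ℝ) + 1)⁻¹) ^ 2 ≤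
      2 * L ^ 2 * (((((R : ℕ) : ℝ)) + 2)⁻¹) ^ 2 * (((1 + ((j : ℕ) : ℝ) / L) ^ 2)⁻¹ + (((((R + 1 - j : ℕ)) : ℝ) + 1)⁻¹) ^ 2) := by
  have hL0 : 0 < L := one_pos.trans_le hL1
  have hj0 : (0 : ℝ) ≤ ((j : ℕ) : ℝ) := Nat.cast_nonneg _
  have hcast : ((((R + 1 - j : ℕ)) : ℝ) + 1) = (((R : ℕ) : ℝ)) + 2 - ((j : ℕ) : ℝ) := by
    rw [Nat.cast_sub (by omega)]; push_cast; ring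
  have hjR' : ((j : ℕ) : ℝ) ≤ ((R : ℕ) : ℝ) := by exact_mod_cast hjR
  refine inv_mul_weight_le (by positivity) (by rw [hcast]; linarith) (by positivity) ?_
  rw [hcast]
  -- `R + 2 ≤ L·(1 + j/L + (R + 2 − j)) = L + j + L(R + 2 − j)`
  have e : L * (1 + ((j : ℕ) : ℝ) / L + ((((R : ℕ) : ℝ)) + 2 - ((j : ℕ) : ℝ))) =
      L + ((j : ℕ) : ℝ) + L * ((((R : ℕ) : ℝ)) + 2 - ((j : ℕ) : ℝ)) := by field_simp
  rw [e]
  nlinarith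

/-- the boundary-distance sum over the window: `Σ_{n ∈ Icc (k₀−R) (k₀+R)} (R + 2 − |k₀ − n|)⁻² ≤ 6` (VS `sum_inv_sq_natAbs_succ_le` from both ends). -/
theorem sum_inv_sq_bdist_le (k₀ : ℤ) (R : ℕ) :
    ∑ n ∈ Icc (k₀ - R) (k₀ + R), (((((R + 1 - (k₀ - n).natAbs : ℕ)) : ℝ) + 1)⁻¹) ^ 2 ≤ 6 := by
  rw [← sum_filter_add_sum_filter_not (Icc (k₀ - R) (k₀ + R)) (fun n : ℤ => n ≤ k₀)]
  have h1 : ∑ n ∈ (Icc (k₀ - R) (k₀ + R)).filter (fun n : ℤ => n ≤ k₀), (((((R + 1 - (k₀ - n).natAbs : ℕ)) : ℝ) + 1)⁻¹) ^ 2 ≤ 3 := by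
    calc ∑ n ∈ (Icc (k₀ - R) (k₀ + R)).filter (fun n : ℤ => n ≤ k₀), (((((R + 1 - (k₀ - n).natAbs : ℕ)) : ℝ) + 1)⁻¹) ^ 2
        = ∑ n ∈ (Icc (k₀ - R) (k₀ + R)).filter (fun n : ℤ => n ≤ k₀), ((((((k₀ - R - 1) - n).natAbs : ℕ) : ℝ) + 1)⁻¹) ^ 2 := by
          refine sum_congr rfl fun n hn => ?_
          have h := mem_filter.mp hn
          have h' := mem_Icc.mp h.1
          have e : R + 1 - (k₀ - n).natAbs = ((k₀ - R - 1) - n).natAbs := by omega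
          rw [e]
      _ ≤ 3 := sum_inv_sq_natAbs_succ_le _ _
  have h2 : ∑ n ∈ (Icc (k₀ - R) (k₀ + R)).filter (fun n : ℤ => ¬ n ≤ k₀), (((((R + 1 - (k₀ - n).natAbs : ℕ)) : ℝ) + 1)⁻¹) ^ 2 ≤ 3 := by
    calc ∑ n ∈ (Icc (k₀ - R) (k₀ + R)).filter (fun n : ℤ => ¬ n ≤ k₀), (((((R + 1 - (k₀ - n).natAbs : ℕ)) : ℝ) + 1)⁻¹) ^ 2
        = ∑ n ∈ (Icc (k₀ - R) (k₀ + R)).filter (fun n : ℤ => ¬ n ≤ k₀), ((((((k₀ + R + 1) - n).natAbs : ℕ) : ℝ) + 1)⁻¹) ^ 2 := by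
          refine sum_congr rfl fun n hn => ?_
          have h := mem_filter.mp hn
          have h' := mem_Icc.mp h.1
          have e : R + 1 - (k₀ - n).natAbs = ((k₀ + R + 1) - n).natAbs := by omega
          rw [e]
      _ ≤ 3 := sum_inv_sq_natAbs_succ_le _ _
  linarith

/-- distance from a window row to the outside: for `n ∈ Icc (k₀−R) (k₀+R)` and `k ∉ Icc (k₀−R) (k₀+R)`, `R + 1 − |k₀ − n| ≤ |n − k|`. [formal bookkeeping] -/
theorem bdist_le_natAbs {k₀ n k : ℤ} {R : ℕ} (hn : n ∈ Icc (k₀ - R) (k₀ + R)) (hk : k ∉ Icc (k₀ - R) (k₀ + R)) :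
    R + 1 - (k₀ - n).natAbs ≤ (n - k).natAbs := by
  rw [mem_Icc] at hn
  rw [mem_Icc, not_and_or, not_le, not_le] at hk
  omega

/-! ### WB.3  ★ The local stability estimate -/

/-- the TAIL CONSTANT `2588·F·L²` (`L = decayScale c δ`) of the local stability estimate. [this file, g58] -/
def stabConst (c δ : ℝ) : ℝ := 2588 * kernelConst c * (((decayScale c δ : ℕ)) : ℝ) ^ 2

/-- `stabConst c δ ≥ 0`. [formal bookkeeping] -/
theorem stabConst_nonneg (hc : 0 < c) (δ : ℝ) : 0 ≤ stabConst c δ := by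
  have hF := kernelConst_nonneg hc
  unfold stabConst; positivity

/-- ★ LOCAL STABILITY OF THE WINDOW INVERSE: for ANY increment field `Δ`, any window `Icc (k₀−R) (k₀+R) ⊆ T`, if the full chain fluxes
`blockApply (fluxBlock …) T Δ` are bounded by `H` on the window and the increments by `D` on `T ∖ window`, then
`‖Δ k₀‖ ≤ modeConst·(H + stabConst·(R+2)⁻²·D)` — the increments outside the window are damped by `(R+2)⁻²`. [this file, g58] -/
theorem increment_le_local (hc : 0 < c) (hL : IsLayeredCrystal c a b w) {κ₀ ε ϱ : ℝ} (hϱ : 0 ≤ ϱ) (hε : ε < 2 * κ₀)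
    (hK : CoerciveZ (layeredKernel a b w) κ₀)
    (hT : ∀ φ : Cell 2 → ℤ → E3, HasFiniteSupport φ → Summable (tailFam ϱ a b w φ) ∧ ∑' x, tailFam ϱ a b w φ x ≤ ε * nnFormZ φ)
    {k₀ : ℤ} {R : ℕ} {T : Finset ℤ} (hWT : Icc (k₀ - R) (k₀ + R) ⊆ T) (Δ : ℤ → E3) {H D : ℝ} (hD0 : 0 ≤ D)
    (hH : ∀ n ∈ Icc (k₀ - R) (k₀ + R), ‖blockApply (fluxBlock hc hL ϱ) T Δ n‖ ≤ H) (hD : ∀ k ∈ T \ Icc (k₀ - R) (k₀ + R), ‖Δ k‖ ≤ D) :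
    ‖Δ k₀‖ ≤ modeConst c (κ₀ - ε / 2) * (H + stabConst c (κ₀ - ε / 2) * (((((R : ℕ) : ℝ)) + 2)⁻¹) ^ 2 * D) := by
  set W : Finset ℤ := Icc (k₀ - R) (k₀ + R) with hWdef
  have hF := kernelConst_nonneg hc
  have hδ : 0 < κ₀ - ε / 2 := by linarith
  obtain ⟨L, hLdef⟩ : ∃ L : ℕ, L = decayScale c (κ₀ - ε / 2) := ⟨_, rfl⟩
  have hL1 : 1 ≤ L := hLdef ▸ one_le_decayScale c (κ₀ - ε / 2)
  have hL1R : (1 : ℝ) ≤ ((L : ℕ) : ℝ) := by exact_mod_cast hL1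
  have hL0R : (0 : ℝ) < ((L : ℕ) : ℝ) := one_pos.trans_le hL1R
  have hk₀ : k₀ ∈ W := by rw [hWdef, mem_Icc]; omega
  have hco := flux_coercive hc hL hϱ hε.le hK hT W
  have hω : ∀ k : ℤ, 0 < (1 + (((k.natAbs : ℕ)) : ℝ) / ((L : ℕ) : ℝ)) ^ 2 := fun k => by positivity
  have hω0 : (1 + ((((0 : ℤ).natAbs : ℕ)) : ℝ) / ((L : ℕ) : ℝ)) ^ 2 = 1 := by simp
  have hΛ' : 588 * kernelConst c / ((L : ℕ) : ℝ) ≤ (κ₀ - ε / 2) / 2 := moment_le_half_of_decayScale_le hc hδ hLdef.symm.le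
  have hΛ : 588 * kernelConst c / ((L : ℕ) : ℝ) < κ₀ - ε / 2 := hΛ'.trans_lt (by linarith)
  have hd0 : ∀ m, m ∉ W → truncW W Δ m = 0 := fun m hm => truncW_of_not_mem Δ hm
  have hwin := window_inverse_bound (B := fluxBlock hc hL ϱ) (W := W) (δ := κ₀ - ε / 2) (Λ := 588 * kernelConst c / ((L : ℕ) : ℝ))
    (ω := fun k : ℤ => (1 + (((k.natAbs : ℕ)) : ℝ) / ((L : ℕ) : ℝ)) ^ 2) (θ := fun u : ℕ => (1 + ((u : ℕ) : ℝ) / ((L : ℕ) : ℝ)) ^ 2 - 1)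
    hδ hco hω hω0 (fun m n => polyProfile_admissible hL0R m n) (fun m _ => fluxBlock_row_moment hc hL ϱ hL1R W m)
    (fun n _ => fluxBlock_col_moment hc hL ϱ hL1R W n) hΛ hd0 hk₀
  rw [truncW_of_mem Δ hk₀] at hwin
  have hH0 : 0 ≤ H := (norm_nonneg _).trans (hH k₀ hk₀)
  -- the rows: window flux of the truncation = full flux − off-window part
  have hrow : ∀ n ∈ W, ‖blockApply (fluxBlock hc hL ϱ) W (truncW W Δ) n‖ ≤
      H + 588 * kernelConst c * (((((R + 1 - (k₀ - n).natAbs : ℕ)) : ℝ) + 1)⁻¹) ^ 2 * D := by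
    intro n hn
    rw [blockApply_truncW]
    have e : blockApply (fluxBlock hc hL ϱ) W Δ n = blockApply (fluxBlock hc hL ϱ) T Δ n - ∑ k ∈ T \ W, fluxBlock hc hL ϱ n k (Δ k) := by
      rw [blockApply_split _ hWT, add_sub_cancel_right]
    rw [e]
    have hfar : ∑ k ∈ T \ W, bandWt n k ≤ 3 * (((((R + 1 - (k₀ - n).natAbs : ℕ)) : ℝ) + 1)⁻¹) ^ 2 :=
      sum_bandWt_le_far _ n fun k hk => bdist_le_natAbs hn (mem_sdiff.mp hk).2
    calc ‖blockApply (fluxBlock hc hL ϱ) T Δ n - ∑ k ∈ T \ W, fluxBlock hc hL ϱ n k (Δ k)‖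
        ≤ ‖blockApply (fluxBlock hc hL ϱ) T Δ n‖ + ‖∑ k ∈ T \ W, fluxBlock hc hL ϱ n k (Δ k)‖ := norm_sub_le _ _
      _ ≤ H + 196 * kernelConst c * (∑ k ∈ T \ W, bandWt n k) * D :=
          add_le_add (hH n hn) (norm_sum_fluxBlock_apply_le hc hL ϱ _ Δ n fun k hk => hD k hk)
      _ ≤ H + 196 * kernelConst c * (3 * (((((R + 1 - (k₀ - n).natAbs : ℕ)) : ℝ) + 1)⁻¹) ^ 2) * D := by gcongr
      _ = H + 588 * kernelConst c * (((((R + 1 - (k₀ - n).natAbs : ℕ)) : ℝ) + 1)⁻¹) ^ 2 * D := by ring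
  -- the weights
  have hweights : ∑ n ∈ W, ((1 + ((((k₀ - n).natAbs : ℕ)) : ℝ) / ((L : ℕ) : ℝ)) ^ 2)⁻¹ * (((((R + 1 - (k₀ - n).natAbs : ℕ)) : ℝ) + 1)⁻¹) ^ 2 ≤
      2 * ((L : ℕ) : ℝ) ^ 2 * (((((R : ℕ) : ℝ)) + 2)⁻¹) ^ 2 * (5 * ((L : ℕ) : ℝ) + 6) := by
    calc ∑ n ∈ W, ((1 + ((((k₀ - n).natAbs : ℕ)) : ℝ) / ((L : ℕ) : ℝ)) ^ 2)⁻¹ * (((((R + 1 - (k₀ - n).natAbs : ℕ)) : ℝ) + 1)⁻¹) ^ 2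
        ≤ ∑ n ∈ W, 2 * ((L : ℕ) : ℝ) ^ 2 * (((((R : ℕ) : ℝ)) + 2)⁻¹) ^ 2 *
            (((1 + ((((k₀ - n).natAbs : ℕ)) : ℝ) / ((L : ℕ) : ℝ)) ^ 2)⁻¹ + (((((R + 1 - (k₀ - n).natAbs : ℕ)) : ℝ) + 1)⁻¹) ^ 2) :=
          sum_le_sum fun n hn => window_weight_le hL1R (by have := mem_Icc.mp hn; omega)
      _ = 2 * ((L : ℕ) : ℝ) ^ 2 * (((((R : ℕ) : ℝ)) + 2)⁻¹) ^ 2 *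
            (∑ n ∈ W, ((1 + ((((k₀ - n).natAbs : ℕ)) : ℝ) / ((L : ℕ) : ℝ)) ^ 2)⁻¹ +
              ∑ n ∈ W, (((((R + 1 - (k₀ - n).natAbs : ℕ)) : ℝ) + 1)⁻¹) ^ 2) := by rw [← mul_sum, sum_add_distrib]
      _ ≤ 2 * ((L : ℕ) : ℝ) ^ 2 * (((((R : ℕ) : ℝ)) + 2)⁻¹) ^ 2 * (5 * ((L : ℕ) : ℝ) + 6) :=
          mul_le_mul_of_nonneg_left (add_le_add (sum_inv_polyProfile_le hL1 W k₀) (sum_inv_sq_bdist_le k₀ R)) (by positivity)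
  have hwsum : ∑ n ∈ W, ((1 + ((((k₀ - n).natAbs : ℕ)) : ℝ) / ((L : ℕ) : ℝ)) ^ 2)⁻¹ * ‖blockApply (fluxBlock hc hL ϱ) W (truncW W Δ) n‖ ≤
      5 * ((L : ℕ) : ℝ) * H + 12936 * kernelConst c * ((L : ℕ) : ℝ) ^ 3 * (((((R : ℕ) : ℝ)) + 2)⁻¹) ^ 2 * D := by
    calc ∑ n ∈ W, ((1 + ((((k₀ - n).natAbs : ℕ)) : ℝ) / ((L : ℕ) : ℝ)) ^ 2)⁻¹ * ‖blockApply (fluxBlock hc hL ϱ) W (truncW W Δ) n‖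
        ≤ ∑ n ∈ W, ((1 + ((((k₀ - n).natAbs : ℕ)) : ℝ) / ((L : ℕ) : ℝ)) ^ 2)⁻¹ *
            (H + 588 * kernelConst c * (((((R + 1 - (k₀ - n).natAbs : ℕ)) : ℝ) + 1)⁻¹) ^ 2 * D) :=
          sum_le_sum fun n hn => mul_le_mul_of_nonneg_left (hrow n hn) (by positivity)
      _ = (∑ n ∈ W, ((1 + ((((k₀ - n).natAbs : ℕ)) : ℝ) / ((L : ℕ) : ℝ)) ^ 2)⁻¹) * H + 588 * kernelConst c * D *
            ∑ n ∈ W, ((1 + ((((k₀ - n).natAbs : ℕ)) : ℝ) / ((L : ℕ) : ℝ)) ^ 2)⁻¹ * (((((R + 1 - (k₀ - n).natAbs : ℕ)) : ℝ) + 1)⁻¹) ^ 2 := by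
          rw [sum_mul, mul_sum, ← sum_add_distrib]
          exact sum_congr rfl fun n _ => by ring
      _ ≤ 5 * ((L : ℕ) : ℝ) * H + 588 * kernelConst c * D * (2 * ((L : ℕ) : ℝ) ^ 2 * (((((R : ℕ) : ℝ)) + 2)⁻¹) ^ 2 * (5 * ((L : ℕ) : ℝ) + 6)) :=
          add_le_add (mul_le_mul_of_nonneg_right (sum_inv_polyProfile_le hL1 W k₀) hH0) (mul_le_mul_of_nonneg_left hweights (by positivity))
      _ ≤ 5 * ((L : ℕ) : ℝ) * H + 12936 * kernelConst c * ((L : ℕ) : ℝ) ^ 3 * (((((R : ℕ) : ℝ)) + 2)⁻¹) ^ 2 * D := by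
          have h11 : 5 * ((L : ℕ) : ℝ) + 6 ≤ 11 * ((L : ℕ) : ℝ) := by linarith
          have h0 : 0 ≤ 588 * kernelConst c * D * (2 * ((L : ℕ) : ℝ) ^ 2 * (((((R : ℕ) : ℝ)) + 2)⁻¹) ^ 2) := by positivity
          nlinarith [mul_le_mul_of_nonneg_left h11 h0]
  -- conclusion
  have hgap0 : 0 < κ₀ - ε / 2 - 588 * kernelConst c / ((L : ℕ) : ℝ) := by linarith
  have hgap : (κ₀ - ε / 2 - 588 * kernelConst c / ((L : ℕ) : ℝ))⁻¹ ≤ 2 / (κ₀ - ε / 2) :=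
    calc (κ₀ - ε / 2 - 588 * kernelConst c / ((L : ℕ) : ℝ))⁻¹ ≤ ((κ₀ - ε / 2) / 2)⁻¹ := inv_anti₀ (by positivity) (by linarith)
      _ = 2 / (κ₀ - ε / 2) := inv_div _ _
  have hpos : 0 ≤ 5 * ((L : ℕ) : ℝ) * H + 12936 * kernelConst c * ((L : ℕ) : ℝ) ^ 3 * (((((R : ℕ) : ℝ)) + 2)⁻¹) ^ 2 * D := by positivity
  have htail : 12936 / 5 * kernelConst c * ((L : ℕ) : ℝ) ^ 2 * (((((R : ℕ) : ℝ)) + 2)⁻¹) ^ 2 * D ≤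
      stabConst c (κ₀ - ε / 2) * (((((R : ℕ) : ℝ)) + 2)⁻¹) ^ 2 * D := by
    have h0 : 0 ≤ kernelConst c * ((L : ℕ) : ℝ) ^ 2 * ((((((R : ℕ) : ℝ)) + 2)⁻¹) ^ 2 * D) := by positivity
    have e1 : stabConst c (κ₀ - ε / 2) * (((((R : ℕ) : ℝ)) + 2)⁻¹) ^ 2 * D = 2588 * (kernelConst c * ((L : ℕ) : ℝ) ^ 2 * ((((((R : ℕ) : ℝ)) + 2)⁻¹) ^ 2 * D)) := by
      unfold stabConst; rw [← hLdef]; ring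
    rw [e1]; nlinarith
  calc ‖Δ k₀‖ ≤ (κ₀ - ε / 2 - 588 * kernelConst c / ((L : ℕ) : ℝ))⁻¹ *
        ∑ n ∈ W, ((1 + ((((k₀ - n).natAbs : ℕ)) : ℝ) / ((L : ℕ) : ℝ)) ^ 2)⁻¹ * ‖blockApply (fluxBlock hc hL ϱ) W (truncW W Δ) n‖ := hwin
    _ ≤ (κ₀ - ε / 2 - 588 * kernelConst c / ((L : ℕ) : ℝ))⁻¹ *
        (5 * ((L : ℕ) : ℝ) * H + 12936 * kernelConst c * ((L : ℕ) : ℝ) ^ 3 * (((((R : ℕ) : ℝ)) + 2)⁻¹) ^ 2 * D) :=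
        mul_le_mul_of_nonneg_left hwsum (inv_nonneg.mpr hgap0.le)
    _ ≤ 2 / (κ₀ - ε / 2) * (5 * ((L : ℕ) : ℝ) * H + 12936 * kernelConst c * ((L : ℕ) : ℝ) ^ 3 * (((((R : ℕ) : ℝ)) + 2)⁻¹) ^ 2 * D) :=
        mul_le_mul_of_nonneg_right hgap hpos
    _ = modeConst c (κ₀ - ε / 2) * (H + 12936 / 5 * kernelConst c * ((L : ℕ) : ℝ) ^ 2 * (((((R : ℕ) : ℝ)) + 2)⁻¹) ^ 2 * D) := by
        unfold modeConst; rw [← hLdef]; field_simp; ring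
    _ ≤ modeConst c (κ₀ - ε / 2) * (H + stabConst c (κ₀ - ε / 2) * (((((R : ℕ) : ℝ)) + 2)⁻¹) ^ 2 * D) :=
        mul_le_mul_of_nonneg_left (by linarith) (modeConst_nonneg c hδ)

/-- the SHAPE of WB: the local stability estimate, closed form. -/
def WindowStabilityShape : Prop :=
  ∀ c : ℝ, 0 < c → ∀ (a b : E3) (w : ℤ → E3) (hL : IsLayeredCrystal c a b w) (κ₀ ε ϱ : ℝ), 0 ≤ ϱ → ε < 2 * κ₀ →
    CoerciveZ (layeredKernel a b w) κ₀ →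
    (∀ φ : Cell 2 → ℤ → E3, HasFiniteSupport φ → Summable (tailFam ϱ a b w φ) ∧ ∑' x, tailFam ϱ a b w φ x ≤ ε * nnFormZ φ) →
    ∀ (hc : 0 < c) (k₀ : ℤ) (R : ℕ) (T : Finset ℤ), Icc (k₀ - R) (k₀ + R) ⊆ T → ∀ (Δ : ℤ → E3) (H D : ℝ), 0 ≤ D →
    (∀ n ∈ Icc (k₀ - R) (k₀ + R), ‖blockApply (fluxBlock hc hL ϱ) T Δ n‖ ≤ H) → (∀ k ∈ T \ Icc (k₀ - R) (k₀ + R), ‖Δ k‖ ≤ D) →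
    ‖Δ k₀‖ ≤ modeConst c (κ₀ - ε / 2) * (H + stabConst c (κ₀ - ε / 2) * (((((R : ℕ) : ℝ)) + 2)⁻¹) ^ 2 * D)

/-- WB holds. [this file, g58] -/
theorem windowStabilityShape_holds : WindowStabilityShape :=
  fun _c _hc0 _a _b _w hL _κ₀ _ε _ϱ hϱ hε hK hT hc _k₀ _R _T hWT Δ _H _D hD0 hH hD => increment_le_local hc hL hϱ hε hK hT hWT Δ hD0 hH hD

end WindowStability

end Summit.AtomisticToContinuum.Crystallization.Theorems.ChartedZeroExcessLayeredLatticeLiouville
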